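import Summits.BirchSwinnertonDyer.BirchSwinnertonDyer.Theorems.ErratumRoadFiveTwoVariableLocalDefectFinite
import Literature.NumberTheory.EllipticCurves.CofreeTorsionFiniteness
import Literature.NumberTheory.EllipticCurves.CofreeContinuousRepNewform
import Literature.NumberTheory.EllipticCurves.BigGaloisRepSelmer
import Literature.NumberTheory.EllipticCurves.SkinnerUrban2014.GL2MainConjecture
import Literature.NumberTheory.EllipticCurves.HeegnerPoints
import Literature.NumberTheory.GaloisRepresentations.AbsGaloisGroupCompact
import Mathlib.RingTheory.QuotSMulTop
import HarnessLib

/-!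
# The v4 stub `stub_localDefectFiniteAnomalous` (S2♭♭) of line `erratum_chain` of crux 25505 `ErratumThm23SigmaLe`
# FROM TWO GALOIS INPUTS about `A_g` and `Γ_{K_𝔭̄}` only: (OPEN) the decomposition group at `𝔭̄` is open in
# `Gal(K_∞/K) ≅ ℤ_p²`, (FIN-N) finite cokernel of `ρ(σ₁) − 1` on `A_g^{G_{K_{∞,𝔭̄}}}` (helper, `--supports stmt-BirchSwinnertonDyer-25505`)

Cell `bsd-stepL`, seat `bsd-stepL-imc-p1` (prover g23, 2026-08-28). Theorems only (no definition, no named fact, no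
`sorry`, no instance, no notation). The INSTANTIATION at the erratum data of the abstract assembly
`LocalDefect.finite_quotSMulTop_X_invariants_of_open` (p641842; with `Sections.*` p641531): for an ordinary newform
datum `Δ`, a number field `K`, a prime `𝔭̄` of `K`, two `ℤ_p`-extensions `κ` (intended anticyclotomic), `κ'`
(intended cyclotomic), the LOCAL control defect `𝓜^{Γ_{K_𝔭̄}}/T_c 𝓜^{Γ_{K_𝔭̄}}` of the iterated big representation
`𝓜 = A_g ⊗ Λ_K^*` restricted to `Γ_{K_𝔭̄}` (`localMap K (Sum.inl 𝔭̄)`) is FINITE as soon as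

* (OPEN) `∃ n, ∀ x y ∈ ℤ_p, ∃ σ ∈ Γ_{K_𝔭̄}` with `κ'(σ) = pⁿx`, `κ(σ) = pⁿy` — the image of `Γ_{K_𝔭̄}` in
  `Gal(K̃_∞/K) ≅ ℤ_p × ℤ_p` (via `(κ', κ)`) is OPEN (global class field theory for `K` imaginary quadratic with
  `p = 𝔭𝔭̄` split: the inertia group at `𝔭̄` has `ℤ_p`-rank one and the Frobenius of `𝔭̄` is independent of it);
* (FIN-N) for every `σ₁ ∈ Γ_{K_𝔭̄}` trivial on `K_∞^{κ}` and non-trivial on `K_∞^{κ'}`, the classes of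
  `N = A_g^{P}`, `P = ker κ|_{Γ_{K_𝔭̄}} ∩ ker κ'|_{Γ_{K_𝔭̄}} = G_{K̃_{∞,𝔭̄}}`, modulo `(ρ(σ₁) − 1)N` are finitely many —
  TRUE by the ordinary shape of `ρ_g|_{G_{ℚ_p}}` [Wiles88, Thm. 2.2], `α_p` not a root of unity [Deligne], and the
  rank-one inertia image (memo `CORNER-25505-imc-p1-g22.md` §2.4): `N_div` is `0` or the unramified unit-root line, on
  which `σ₁` acts by `α_p^{a(σ₁)}` with `a(σ₁) ∉ p`-torsion-free-kernel, a 1-unit `≠ 1`, so `ρ(σ₁) − 1` is onto `N_div`.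

`finite_localDefect_of_open_of_finN` is the bare statement; `stub_localDefectFiniteAnomalous_of_inputs` repackages it with
the binders of the registered line: the v4 stub S2♭♭ (type VERBATIM = the binder `hLoc` of the tree theorem
`ErratumChainV4.erratumThm23SigmaLe_of_twoVarCore_of_localDefect`, p638561) follows from the two displayed
∀-statements (OPEN) and (FIN-N) — the proposed v5 stubs `stub_openDecompositionAtPbar` ∕ `stub_finiteCokernelOnFixedPart`,
so that v5 = S1 + two Galois-input stubs with `_of` BY NAME. Compactness of `Γ_{K_𝔭̄}`
(`absoluteGaloisGroup_compactSpace`) and `p`-primarity of `A_g` (`Cofree.exists_pow_psmul_eq_zero`) are the tree's.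

HONEST FRAMING: conditional on the two displayed inputs, which are NOT proved here ((OPEN) is class field theory,
(FIN-N) needs the Frobenius semantics at `p` of the datum — neither is in the tree); nothing about BSD for any pair;
closes: none (T7).

## References
* [JetchevSkinnerWan2017] §3.4, Lemma 3.4.1 and its proof (arXiv:1512.06894 p. 14), Case 3(b) (p. 13).
* [Castella2018Erratum] Lemma 2.1 and Thm. 2.3 (p. 2–4).
* [Wiles1988] Thm. 2.2 (the ordinary shape at `p`).
-/

noncomputable section

-- D-0017: single-problem summit, the namespace repeats the problem name by design.
set_option linter.dupNamespace false
set_option autoImplicit false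

open scoped Classical

open PowerSeries NumberField IsDedekindDomain Field
  Literature.NumberTheory.GaloisRepresentations Literature.NumberTheory.EllipticCurves
  Literature.NumberTheory.EllipticCurves.ModularForms Literature.NumberTheory.EllipticCurves.BigGaloisRep
  Literature.NumberTheory.EllipticCurves.GreenbergSelmer Literature.NumberTheory.EllipticCurves.BigRepModule

namespace Summit.BirchSwinnertonDyer.BirchSwinnertonDyer.Theorems.ErratumThm23TwoVariable.LocalDefectAtData

/-! ## §1 The local control defect at `𝔭̄` is finite from (OPEN) + (FIN-N) — bare form -/

set_option maxHeartbeats 400000 in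
-- statement-sized packages over the iterated big representation (as p627206 ∕ p638561); the proof is glue
/-- **`𝓜^{Γ_{K_𝔭̄}}/T_c 𝓜^{Γ_{K_𝔭̄}}` is FINITE from (OPEN) + (FIN-N)** for the iterated big representation
`𝓜 = AnticyclotomicBigGaloisRep κ' (AnticyclotomicBigGaloisRep κ (A_g|_{Γ_K}))` restricted to `Γ_{K_𝔭̄}`: the abstract
assembly `LocalDefect.finite_quotSMulTop_X_invariants_of_open` at `G = Γ_{K_𝔭̄}` (compact), `κ₁ = κ'|`, `κ₂ = κ|`,
`A = A_g` (`p`-primary), after `bigRep_restrict` (twice). This is the local input of [JSW17, Lemma 3.4.1]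
("`𝓜^{G_{K_v}}/(γ₊ − 1)𝓜^{G_{K_v}}` … finite") as a consequence of two statements about `A_g` and `Γ_{K_𝔭̄}`.
[cite: JetchevSkinnerWan2017, §3.4, Lemma 3.4.1, proof (arXiv:1512.06894 p. 14)] -/
theorem finite_localDefect_of_open_of_finN {p : ℕ} [Fact p.Prime] {M : ℕ} [NeZero M] {k : ℤ}
    {g : CuspForm (CongruenceSubgroup.Gamma0 M) k} {ιg : coeffField g →+* PadicAlgCl p}
    (Δ : OrdinaryNewformDatum g p ιg) (K : Type) [Field K] [NumberField K] (𝔭bar : HeightOneSpectrum (𝓞 K))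
    (κ κ' : ZpExtension K p)
    [TopologicalSpace (PowerSeries (padicCoeffIntegers ιg))]
    [TopologicalSpace (PowerSeries (PowerSeries (padicCoeffIntegers ιg)))]
    [ContinuousSMul (PowerSeries (PowerSeries (padicCoeffIntegers ιg)))
      (BigRepModule (PowerSeries (padicCoeffIntegers ιg)) p
        (BigRepModule (padicCoeffIntegers ιg) p (Cofree Δ.ρ (padicCoeffField ιg))))]
    (hOpen : ∃ n : ℕ, ∀ x y : ℤ_[p], ∃ σ : LocalGroup K (Sum.inl 𝔭bar),
      (κ' (localMap K (Sum.inl 𝔭bar) σ)).toAdd = p ^ n * x ∧ (κ (localMap K (Sum.inl 𝔭bar) σ)).toAdd = p ^ n * y)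
    (hFin : ∀ σ₁ : LocalGroup K (Sum.inl 𝔭bar), κ (localMap K (Sum.inl 𝔭bar) σ₁) = 1 →
      κ' (localMap K (Sum.inl 𝔭bar) σ₁) ≠ 1 →
      ∃ S : Finset (Cofree Δ.ρ (padicCoeffField ιg)), ∀ a : Cofree Δ.ρ (padicCoeffField ιg),
        (∀ σ : LocalGroup K (Sum.inl 𝔭bar), κ' (localMap K (Sum.inl 𝔭bar) σ) = 1 →
          κ (localMap K (Sum.inl 𝔭bar) σ) = 1 → (Δ.cofreeRepOver K) (localMap K (Sum.inl 𝔭bar) σ) a = a) →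
        ∃ s ∈ S, ∃ b : Cofree Δ.ρ (padicCoeffField ιg),
          (∀ σ : LocalGroup K (Sum.inl 𝔭bar), κ' (localMap K (Sum.inl 𝔭bar) σ) = 1 →
            κ (localMap K (Sum.inl 𝔭bar) σ) = 1 → (Δ.cofreeRepOver K) (localMap K (Sum.inl 𝔭bar) σ) b = b) ∧
          a = s + ((Δ.cofreeRepOver K) (localMap K (Sum.inl 𝔭bar) σ₁) b - b)) :
    Finite (QuotSMulTop (PowerSeries.X : PowerSeries (PowerSeries (padicCoeffIntegers ιg)))
      ↥((((AnticyclotomicBigGaloisRep κ' (AnticyclotomicBigGaloisRep κ (Δ.cofreeRepOver K))).restrict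
        (localMap K (Sum.inl 𝔭bar))).toTopRep).ρ.invariants)) := by
  haveI : CompactSpace (LocalGroup K (Sum.inl 𝔭bar)) :=
    Literature.NumberTheory.GaloisRepresentations.absoluteGaloisGroup_compactSpace (𝔭bar.adicCompletion K)
  -- the abstract assembly at `G = Γ_{K_𝔭̄}`, `κ₁ = κ'|`, `κ₂ = κ|`, `A = A_g`
  have key := LocalDefect.finite_quotSMulTop_X_invariants_of_open (p := p)
    (κ'.toContinuousMonoidHom.comp (localMap K (Sum.inl 𝔭bar)))
    (κ.toContinuousMonoidHom.comp (localMap K (Sum.inl 𝔭bar)))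
    ((Δ.cofreeRepOver K).restrict (localMap K (Sum.inl 𝔭bar)))
    (fun a ↦ Cofree.exists_pow_psmul_eq_zero ιg Δ.ρ a) hOpen hFin
  -- the restricted iterate IS the iterate of the restricted data (`bigRep_restrict`, twice)
  have e : (((AnticyclotomicBigGaloisRep κ' (AnticyclotomicBigGaloisRep κ (Δ.cofreeRepOver K))).restrict
        (localMap K (Sum.inl 𝔭bar))).toTopRep).ρ.invariants =
      ((bigRep (κ'.toContinuousMonoidHom.comp (localMap K (Sum.inl 𝔭bar)))
        (bigRep (κ.toContinuousMonoidHom.comp (localMap K (Sum.inl 𝔭bar)))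
          ((Δ.cofreeRepOver K).restrict (localMap K (Sum.inl 𝔭bar))))).toTopRep).ρ.invariants := by
    have e₀ : (AnticyclotomicBigGaloisRep κ' (AnticyclotomicBigGaloisRep κ (Δ.cofreeRepOver K))).restrict
          (localMap K (Sum.inl 𝔭bar)) =
        bigRep (κ'.toContinuousMonoidHom.comp (localMap K (Sum.inl 𝔭bar)))
          (bigRep (κ.toContinuousMonoidHom.comp (localMap K (Sum.inl 𝔭bar)))
            ((Δ.cofreeRepOver K).restrict (localMap K (Sum.inl 𝔭bar)))) :=
      (bigRep_restrict κ'.toContinuousMonoidHom (bigRep κ.toContinuousMonoidHom (Δ.cofreeRepOver K))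
        (localMap K (Sum.inl 𝔭bar))).trans (by
          rw [bigRep_restrict κ.toContinuousMonoidHom (Δ.cofreeRepOver K) (localMap K (Sum.inl 𝔭bar))])
    rw [e₀]
  exact (congrArg (fun T : Submodule (PowerSeries (PowerSeries (padicCoeffIntegers ιg)))
      (BigRepModule (PowerSeries (padicCoeffIntegers ιg)) p
        (BigRepModule (padicCoeffIntegers ιg) p (Cofree Δ.ρ (padicCoeffField ιg)))) ↦
    Finite (QuotSMulTop (PowerSeries.X : PowerSeries (PowerSeries (padicCoeffIntegers ιg))) ↥T)) e).mpr key

/-! ## §2 The registered v4 stub S2♭♭ from the two Galois inputs, BY THE BINDERS OF THE LINE -/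

set_option maxHeartbeats 400000 in
-- statement-sized packages over the iterated big representation (as p638561); the proof is glue
/-- **S2♭♭ `stub_localDefectFiniteAnomalous` (v4 of `Lines/erratum_chain.lean`, statement VERBATIM = binder `hLoc` of
`ErratumChainV4.erratumThm23SigmaLe_of_twoVarCore_of_localDefect`) from the two Galois inputs** (OPEN) =
`hOpen` (proposed v5 stub `stub_openDecompositionAtPbar`: the decomposition group at `𝔭̄` is open in `Gal(K̃_∞/K) ≅ ℤ_p²`,
class field theory) and (FIN-N) = `hFin` (proposed v5 stub `stub_finiteCokernelOnFixedPart`: finite cokernel of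
`ρ(σ₁) − 1` on `A_g^{G_{K̃_{∞,𝔭̄}}}` for `σ₁` trivial on the `κ`-tower and non-trivial on the `κ'`-tower). The corner
hypothesis `¬(dec)` and the other binders of S2♭♭ are not used beyond feeding the two inputs.
[cite: JetchevSkinnerWan2017, §3.4, Lemma 3.4.1 and proof (arXiv:1512.06894 p. 14)]
[cite: Castella2018Erratum, Lemma 2.1 and Thm. 2.3] -/
theorem stub_localDefectFiniteAnomalous_of_inputs
    (hOpen :
      ∀ {p : ℕ} [Fact p.Prime] (K : Type) [Field K] [NumberField K] (𝔭bar : HeightOneSpectrum (𝓞 K))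
        (κ κ' : ZpExtension K p),
        3 < p → IsImaginaryQuadratic K → ((Ideal.span {(p : ℤ)}).primesOver (𝓞 K)).ncard = 2 →
        ((p : ℕ) : 𝓞 K) ∈ 𝔭bar.asIdeal → κ.IsAnticyclotomic → κ'.IsCyclotomic →
        ∃ n : ℕ, ∀ x y : ℤ_[p], ∃ σ : LocalGroup K (Sum.inl 𝔭bar),
          (κ' (localMap K (Sum.inl 𝔭bar) σ)).toAdd = p ^ n * x ∧
            (κ (localMap K (Sum.inl 𝔭bar) σ)).toAdd = p ^ n * y)
    (hFin :
      ∀ {p : ℕ} [Fact p.Prime] {M : ℕ} [NeZero M] {k : ℤ}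
        (g : CuspForm (CongruenceSubgroup.Gamma0 M) k) (ιg : coeffField g →+* PadicAlgCl p)
        (Δ : OrdinaryNewformDatum g p ιg)
        (K : Type) [Field K] [NumberField K] (𝔭bar : HeightOneSpectrum (𝓞 K)) (κ κ' : ZpExtension K p),
        IsNewform0 g → 2 ≤ k → Even k → ¬ p ∣ M → 3 < p →
        ‖ιg ⟨(UpperHalfPlane.qExpansion 1 ⇑g).coeff p, coeff_mem_coeffField g p⟩‖ = 1 →
        IsImaginaryQuadratic K → ((Ideal.span {(p : ℤ)}).primesOver (𝓞 K)).ncard = 2 →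
        ((p : ℕ) : 𝓞 K) ∈ 𝔭bar.asIdeal → κ.IsAnticyclotomic → κ'.IsCyclotomic →
        ∀ σ₁ : LocalGroup K (Sum.inl 𝔭bar), κ (localMap K (Sum.inl 𝔭bar) σ₁) = 1 →
          κ' (localMap K (Sum.inl 𝔭bar) σ₁) ≠ 1 →
          ∃ S : Finset (Cofree Δ.ρ (padicCoeffField ιg)), ∀ a : Cofree Δ.ρ (padicCoeffField ιg),
            (∀ σ : LocalGroup K (Sum.inl 𝔭bar), κ' (localMap K (Sum.inl 𝔭bar) σ) = 1 →
              κ (localMap K (Sum.inl 𝔭bar) σ) = 1 →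
              (Δ.cofreeRepOver K) (localMap K (Sum.inl 𝔭bar) σ) a = a) →
            ∃ s ∈ S, ∃ b : Cofree Δ.ρ (padicCoeffField ιg),
              (∀ σ : LocalGroup K (Sum.inl 𝔭bar), κ' (localMap K (Sum.inl 𝔭bar) σ) = 1 →
                κ (localMap K (Sum.inl 𝔭bar) σ) = 1 →
                (Δ.cofreeRepOver K) (localMap K (Sum.inl 𝔭bar) σ) b = b) ∧
              a = s + ((Δ.cofreeRepOver K) (localMap K (Sum.inl 𝔭bar) σ₁) b - b)) :
    ∀ {p : ℕ} [Fact p.Prime] {M : ℕ} [NeZero M] {k : ℤ}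
      (g : CuspForm (CongruenceSubgroup.Gamma0 M) k) (ιg : coeffField g →+* PadicAlgCl p)
      (Δ : OrdinaryNewformDatum g p ιg)
      (K : Type) [Field K] [NumberField K] (𝔭bar : HeightOneSpectrum (𝓞 K)) (κ : ZpExtension K p)
      (γ : absoluteGaloisGroup K) [Fact (κ.IsTopGenerator γ)] (S : Finset (HeightOneSpectrum (𝓞 K))),
      IsNewform0 g → 2 ≤ k → Even k → ¬ p ∣ M → 3 < p →
      ‖ιg ⟨(UpperHalfPlane.qExpansion 1 ⇑g).coeff p, coeff_mem_coeffField g p⟩‖ = 1 →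
      IsImaginaryQuadratic K → ((Ideal.span {(p : ℤ)}).primesOver (𝓞 K)).ncard = 2 →
      ((p : ℕ) : 𝓞 K) ∈ 𝔭bar.asIdeal →
      SkinnerUrban2014.IsResiduallyIrreducible Δ →
      (∃ v : HeightOneSpectrum (𝓞 ℚ), SkinnerUrban2014.IsResiduallyRamifiedAt Δ v ∧
        ((Rat.HeightOneSpectrum.primesEquiv v : Nat.Primes) : ℕ) ∣ M ∧
        ¬ ((Rat.HeightOneSpectrum.primesEquiv v : Nat.Primes) : ℕ) ^ 2 ∣ M ∧
        ((Ideal.span {(((Rat.HeightOneSpectrum.primesEquiv v : Nat.Primes) : ℕ) : ℤ)}).primesOver (𝓞 K)).ncard ≠ 2) →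
      κ.IsAnticyclotomic → (∀ w ∈ S, ((p : ℕ) : 𝓞 K) ∉ w.asIdeal) →
      (∀ w : HeightOneSpectrum (𝓞 K), ((M : ℕ) : 𝓞 K) ∈ w.asIdeal → w ∈ S) →
      -- the corner `¬(dec)`: a non-zero `Γ_{K_𝔭̄}`-fixed `p`-power-torsion element of `A_g` ("anomalous at `𝔭̄`")
      ¬ (∀ a : Cofree Δ.ρ (padicCoeffField ιg),
          (∀ σ : LocalGroup K (Sum.inl 𝔭bar), (Δ.cofreeRepOver K) (localMap K (Sum.inl 𝔭bar) σ) a = a) →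
          (∃ j : ℕ, p ^ j • a = 0) → a = 0) →
      -- the complementary CYCLOTOMIC direction `κ'` with a generator `γ'`
      ∀ (κ' : ZpExtension K p) (γ' : absoluteGaloisGroup K) [Fact (κ'.IsTopGenerator γ')], κ'.IsCyclotomic →
      ∀ [TopologicalSpace (PowerSeries (padicCoeffIntegers ιg))]
        [ContinuousSMul (PowerSeries (padicCoeffIntegers ιg))
          (BigRepModule (padicCoeffIntegers ιg) p (Cofree Δ.ρ (padicCoeffField ιg)))]
        [TopologicalSpace (PowerSeries (PowerSeries (padicCoeffIntegers ιg)))]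
        [ContinuousSMul (PowerSeries (PowerSeries (padicCoeffIntegers ιg)))
          (BigRepModule (PowerSeries (padicCoeffIntegers ιg)) p
            (BigRepModule (padicCoeffIntegers ιg) p (Cofree Δ.ρ (padicCoeffField ιg))))],
      -- the LOCAL control defect at the strict prime is FINITE: `𝓜^{Γ_{K_𝔭̄}}/T_c 𝓜^{Γ_{K_𝔭̄}}` finite
      Finite (QuotSMulTop (PowerSeries.X : PowerSeries (PowerSeries (padicCoeffIntegers ιg)))
        ↥((((AnticyclotomicBigGaloisRep κ' (AnticyclotomicBigGaloisRep κ (Δ.cofreeRepOver K))).restrict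
          (localMap K (Sum.inl 𝔭bar))).toTopRep).ρ.invariants)) := by
  intro p _ M _ k g ιg Δ K _ _ 𝔭bar κ γ _ S h1 h2 h3 h5 h6 h8 h9 h11 h14 _h16 _h17 h20 _h21 _h22 _hdec κ' γ' _
    hκ' _ _ _ _
  exact finite_localDefect_of_open_of_finN Δ K 𝔭bar κ κ' (hOpen K 𝔭bar κ κ' h6 h9 h11 h14 h20 hκ')
    (hFin g ιg Δ K 𝔭bar κ κ' h1 h2 h3 h5 h6 h8 h9 h11 h14 h20 hκ')

end Summit.BirchSwinnertonDyer.BirchSwinnertonDyer.Theorems.ErratumThm23TwoVariable.LocalDefectAtData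

end
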